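import Summits.BirchSwinnertonDyer.Rank1Residual.P2.ShuZhaiThirtySixReduction
import Summits.BirchSwinnertonDyer.Rank1Residual.X12.CMIsogenyInvariance
import Literature.NumberTheory.EllipticCurves.Wuthrich2014.ShaBoundProofs
import HarnessLib

/-!
# Cell `bsd-print-cf2` (D-0131 (2) PRINT TIER, leaf CornerF @ `p = 2`), prover p3 — file 6: the Shu–Zhai
# `36a1` slice of `WAllCornerFTwo` extended to the whole `ℚ`-ISOGENY CLASS of each twist (Cassels'
# isogeny invariance of the BSD quotient, BY NAME) — so the twists of `36a2`, `36a3`, `36a4` as well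

HONEST FRAMING. Companion of `P2/ShuZhaiThirtySix{Curve,Admissible,Slices,Reduction}.lean` (HONEST
FRAMING in `…Slices.lean`). The leaf `Summit.BirchSwinnertonDyer.WAllCornerFTwo` is OPEN AS A CLASS;
nothing class-wide is closed; no named fact introduced. Shu–Zhai 2021 Thm 1.2 / 1.4 are printed for the
OPTIMAL curve `E = 36a1` and its twists `E^{(−pM)}`; Miller's `BSD(·,2)` and the analytic rank are
`ℚ`-isogeny invariants (Cassels 1965 / Milne ADT I.7.3, the tree's named fact
`WeierstrassCurve.bsdRHS_eq_of_isIsogenous` — ALREADY a conjunct of the bundle 𝔅_inert of route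
`PrintCf2` item 20363 —, Faltings for `L`, tree theorems `Wuthrich2014.bsdp_of_isIsogenous`,
`analyticRank_eq_of_isIsogenous'`), so every globally minimal `W` that is `ℚ`-ISOGENOUS to
`36a1^{(−p∏q)}` (`p ≡ 23 (mod 24)` prime, `Q ⊂ {primes ≡ 5 (mod 12)}`, `∏q ≡ 1 (mod 24)`) — in
particular every model of the twists of `36a2 = E′ = E/E[2](ℚ)` (`j = 54000`), `36a3`, `36a4` — has
`ord_{s=1} L(W,s) = 1` and satisfies `BSD(W,2)`, granted the facts and the display hypotheses of
file 3. Membership in the leaf and in the non-split half (`HasCM`, `CMInert W 2`) is transported along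
the isogeny (tree `X12.hasCM_of_isIsogenous`, `X12.cmInert_iff_of_isIsogenous`). beyond-print: NO
(printed theorem + isogeny invariance).

References: [ShuZhai2021] Thm 1.2 / 1.4, §5.2 Table row 36a1; [MilneADT2006] Thm I.7.3 (Cassels);
[Miller2011LMS] Def 1.1 and §1 ("BSD(E,p) is an isogeny invariant"); [SilvermanAEC2009] III.6, VII.7.2.
-/

noncomputable section

open scoped Classical

open WeierstrassCurve NumberField Literature.NumberTheory.EllipticCurves
  Literature.NumberTheory.EllipticCurves.Rank1Residual
  Literature.NumberTheory.EllipticCurves.ModularForms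
  Literature.NumberTheory.EllipticCurves.ShuZhai2021
  Summit.BirchSwinnertonDyer.Rank1Residual

set_option autoImplicit false

namespace Summit.BirchSwinnertonDyer.Rank1Residual.P2

/-! ## §1 The pair theorem on the isogeny class of a Shu–Zhai twist of `36a1` -/

/-- **`ord_{s=1} L(W,s) = 1 ∧ BSD(W,2)` for every globally minimal `W` that is `ℚ`-ISOGENOUS to the
Shu–Zhai twist `36a1^{(−pM)}`** (`p ≡ 23 (mod 24)` prime, `Q` admissible primes `≠ p` with the
`ℚ(√M)`-condition, `M = ∏ q*`): Shu–Zhai Thm 1.2 / 1.4 on a globally minimal model `WpM` of the twist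
(file 3), then Cassels' isogeny invariance (`hCassels` = `bsdRHS_eq_of_isIsogenous`, tree
`Wuthrich2014.bsdp_of_isIsogenous`; `Ш(WpM)` finite by Thm 1.2, `L′(WpM,1) ≠ 0` by modularity) and
Faltings (`analyticRank_eq_of_isIsogenous'`). [cite: ShuZhai2021, Thm. 1.2 and Thm. 1.4]
[cite: MilneADT2006, Thm. I.7.3] [cite: Miller2011LMS, §1 and Def. 1.1] -/
theorem analyticRank_eq_one_and_bsdp_two_of_isIsogenous_twist_curve36a1
    (hCassels : bsdRHS_eq_of_isIsogenous) (h12 : thm12_ranks_of_twists)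
    (h14 : thm14_twoPartBSD_of_twists) (hCM : bsdTriple_of_hasCM_of_L_one_ne_zero)
    (hmod : hasEntireLFunction_rat)
    (Dt : ModularParametrizationData curve36a1 (curve36a1.conductorNorm ℤ))
    (hopt : IsOptimalDatum curve36a1 Dt) (hcusp : CuspZeroNotInTwice curve36a1 Dt) (hc : ¬ (2 : ℤ) ∣ Dt.c)
    {p : ℕ} (hp : p.Prime) (h24 : p % 24 = 23)
    {Q : Finset ℕ} (hQ : ∀ q ∈ Q, IsAdmissible curve36a1 curve36a1' q ∧ q ≠ p)
    (hQM : AllPrimesSplitInSqrt (2 * curve36a1.conductorNorm ℤ) (∏ q ∈ Q, qStar q))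
    (W : WeierstrassCurve ℚ) [W.IsElliptic] [W.IsGloballyMinimal]
    (hiso : IsIsogenous W (curve36a1.quadraticTwist ((-(p : ℤ) * ∏ q ∈ Q, qStar q : ℤ) : ℚ))) :
    W.analyticRank = 1 ∧ BSDp W 2 := by
  have hS := thm12Setting_curve36a1 Dt hopt hcusp hp h24 hQ
  have hd0 : ((-(p : ℤ) * ∏ q ∈ Q, qStar q : ℤ) : ℚ) ≠ 0 :=
    neg_p_mul_ne_zero_of_thm12Setting hS Q (fun q hq => by exact_mod_cast (hQ q hq).1.1.ne_zero)
  have hd : ((∏ q ∈ Q, qStar q : ℤ) : ℚ) ≠ 0 := by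
    have h := hd0
    push_cast at h ⊢
    exact (mul_ne_zero_iff.mp h).2
  haveI := curve36a1.isElliptic_quadraticTwist hd0
  obtain ⟨WpM, _, _, C, hC⟩ := exists_globallyMinimal_twist curve36a1 hd0
  obtain ⟨hr, hbsd⟩ := analyticRank_eq_one_and_bsdp_two_of_twist_curve36a1 h12 h14 hCM hmod Dt hopt
    hcusp hc hp h24 hQ hQM WpM ⟨C, hC⟩
  -- `W ∼ 36a1^{(−pM)} ≅ WpM`
  have hiso' : IsIsogenous W WpM := hiso.trans' (by rw [← hC]; exact isIsogenous_smul _ C)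
  -- `Ш(WpM)` finite (Thm 1.2) and `L′(WpM,1) ≠ 0` (modularity)
  obtain ⟨WM, _, _, hWM⟩ := exists_globallyMinimal_twist curve36a1 hd
  obtain ⟨-, -, -, -, -, hfin⟩ := h12 curve36a1 Dt curve36a1' p Q hS WM WpM hWM ⟨C, hC⟩
  haveI := hfin
  exact ⟨(analyticRank_eq_of_isIsogenous' hiso').trans hr,
    Wuthrich2014.bsdp_of_isIsogenous hCassels hiso' hfin (WpM.leadingLCoeff_ne_zero_holds (hmod WpM)) hbsd⟩

/-- **The EXPLICIT two-parameter family, isogeny-class form**: `p ≡ 23 (mod 24)` prime, `Q` any finite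
set of primes `≡ 5 (mod 12)` with `∏ q ≡ 1 (mod 24)`; every globally minimal `W` `ℚ`-isogenous to
`36a1^{(−p∏q)}` has `ord_{s=1} L = 1` and `BSD(W,2)`. [cite: ShuZhai2021, Thm. 1.2, Thm. 1.4, §5.2 Table row 36a1]
[cite: MilneADT2006, Thm. I.7.3] -/
theorem analyticRank_eq_one_and_bsdp_two_of_isIsogenous_twist_curve36a1_explicit
    (hCassels : bsdRHS_eq_of_isIsogenous) (h12 : thm12_ranks_of_twists)
    (h14 : thm14_twoPartBSD_of_twists) (hCM : bsdTriple_of_hasCM_of_L_one_ne_zero)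
    (hmod : hasEntireLFunction_rat)
    (Dt : ModularParametrizationData curve36a1 (curve36a1.conductorNorm ℤ))
    (hopt : IsOptimalDatum curve36a1 Dt) (hcusp : CuspZeroNotInTwice curve36a1 Dt) (hc : ¬ (2 : ℤ) ∣ Dt.c)
    {p : ℕ} (hp : p.Prime) (h24 : p % 24 = 23)
    {Q : Finset ℕ} (hQ : ∀ q ∈ Q, q.Prime ∧ q % 12 = 5) (hM : (∏ q ∈ Q, q) % 24 = 1)
    (W : WeierstrassCurve ℚ) [W.IsElliptic] [W.IsGloballyMinimal]
    (hiso : IsIsogenous W (curve36a1.quadraticTwist (-((p * ∏ q ∈ Q, q : ℕ) : ℚ)))) :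
    W.analyticRank = 1 ∧ BSDp W 2 := by
  refine analyticRank_eq_one_and_bsdp_two_of_isIsogenous_twist_curve36a1 hCassels h12 h14 hCM hmod Dt hopt
    hcusp hc hp h24 (admissible_of_forall_mod_twelve h24 hQ) (allPrimesSplitInSqrt_two_mul_conductorNorm_prod hQ hM)
    W ?_
  rw [prod_qStar_eq_of_forall_mod_twelve hQ]
  push_cast
  simpa [neg_mul] using hiso

/-! ## §2 Membership along the isogeny -/

/-- **Every elliptic `W` `ℚ`-isogenous to a twist of `36a1` has CM and `2` INERT in its CM field** (CM
and the CM field are isogeny invariants: tree `X12.hasCM_of_isIsogenous`, `X12.cmInert_iff_of_isIsogenous`;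
the twist itself has `j = 0`). [cite: SilvermanAEC2009, Cor. III.9.4 and III.6] -/
theorem hasCM_and_cmInert_two_of_isIsogenous_twist_curve36a1 {d : ℚ} (hd : d ≠ 0)
    (W : WeierstrassCurve ℚ) [W.IsElliptic] (hiso : IsIsogenous W (curve36a1.quadraticTwist d)) :
    W.HasCM ∧ CMInert W 2 := by
  haveI := curve36a1.isElliptic_quadraticTwist hd
  have hT : (curve36a1.quadraticTwist d).HasCM :=
    hasCM_of_smul_twist_curve36a1 hd (show (1 : VariableChange ℚ) • curve36a1.quadraticTwist d = _ from
      one_smul _ _)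
  have hcmW : W.HasCM := X12.hasCM_of_isIsogenous hiso.symm_of_charZero hT
  refine ⟨hcmW, (X12.cmInert_iff_of_isIsogenous hiso hcmW 2).2 ?_⟩
  exact (cmInert_two_iff_of_hasCM hT).2 (Or.inl (by
    rw [j_eq_zero_of_smul_twist_curve36a1 hd (show (1 : VariableChange ℚ) • curve36a1.quadraticTwist d = _
      from one_smul _ _)]
    simp [cmFieldDiscrOfJ]))

/-! ## §3 The slice on the isogeny class, in LEAF SHAPE -/

/-- **SLICE SZ36-ISOGENY-CLASS (in print + Cassels, binders of 𝔅_inert ∪ {ARS06}).** In the shape of the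
leaf `WAllCornerFTwo` / item 20363: every globally minimal CM curve of analytic rank one with `2` inert
in its CM field that is `ℚ`-ISOGENOUS to an explicit Shu–Zhai twist `36a1^{(−p∏q)}` (`p ≡ 23 (mod 24)`
prime, `Q ⊂ {primes ≡ 5 (mod 12)}`, `∏ q ≡ 1 (mod 24)`) satisfies `BSD(W,2)` — granted BY NAME Cassels
(`hCassels`), Shu–Zhai Thm 1.2 / 1.4, row C8, modularity, ARS06 Thm 2.6, and the two display
hypotheses on `36a1`. Covers the twists of all four curves `36a1–36a4` of the class. beyond-print: NO.
[cite: ShuZhai2021, Thm. 1.2, Thm. 1.4, §5.2 Table row 36a1] [cite: MilneADT2006, Thm. I.7.3]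
[cite: AgasheRibetStein2006, Thm. 2.6] [cite: Miller2011LMS, Def. 1.1] -/
theorem cornerFTwo_shuZhaiThirtySix_isogenyClass (hCassels : bsdRHS_eq_of_isIsogenous)
    (h12 : thm12_ranks_of_twists) (h14 : thm14_twoPartBSD_of_twists)
    (hCM : bsdTriple_of_hasCM_of_L_one_ne_zero) (hmod : hasEntireLFunction_rat)
    (Dt : ModularParametrizationData curve36a1 (curve36a1.conductorNorm ℤ))
    (hopt : IsOptimalDatum curve36a1 Dt) (hcusp : CuspZeroNotInTwice curve36a1 Dt)
    (hARS : AgasheRibetStein2006.cremona_abs_maninConstant_eq_one_of_level_le) :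
    ∀ (W : WeierstrassCurve ℚ) [W.IsElliptic] [W.IsGloballyMinimal], W.HasCM → W.analyticRank = 1 →
      CMInert W 2 →
      ∀ (p : ℕ), p.Prime → p % 24 = 23 →
      ∀ (Q : Finset ℕ), (∀ q ∈ Q, q.Prime ∧ q % 12 = 5) → (∏ q ∈ Q, q) % 24 = 1 →
        IsIsogenous W (curve36a1.quadraticTwist (-((p * ∏ q ∈ Q, q : ℕ) : ℚ))) → BSDp W 2 :=
  fun W _ _ _ _ _ _ hp h24 _ hQ hM hiso =>
    (analyticRank_eq_one_and_bsdp_two_of_isIsogenous_twist_curve36a1_explicit hCassels h12 h14 hCM hmod Dt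
      hopt hcusp (not_two_dvd_c_of_isOptimalDatum_curve36a1 hARS Dt hopt) hp h24 hQ hM W hiso).2

end Summit.BirchSwinnertonDyer.Rank1Residual.P2

end
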